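import Literature.MathematicalPhysics.QuantumFieldTheory.Balaban1983to89.B9Eq3120DeltaPiPrimeFormTwoBackgroundsClosed
import Literature.MathematicalPhysics.QuantumFieldTheory.Balaban1983to89.B9Eq353FormDefectTowerTwoBackgrounds
import Literature.MathematicalPhysics.QuantumFieldTheory.Balaban1983to89.B9Thm311SmallFieldCoercivityTowerClosed

/-!
# `Balaban1983to89.B9Eq353FormDefectTowerPiTwoBackgrounds` — T. Bałaban, *Propagators for lattice gauge theories in a background field*, Commun. Math. Phys.
# **99** (1985) 389–434 [Balaban1985BackgroundPropagators] (3.122) p. 420, (3.119)–(3.120) p. 419, (3.26) p. 395, (3.52)–(3.53) p. 400, (3.82)–(3.86) p. 407,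
# Thm 3.4 p. 400: **THE FORM DEFECT OF PRINT's OPERATOR `Δ̃_{a,k} = π_k†Δ^ηπ_k + D R_k D* + Q_k*aQ_k` ((3.122)) BETWEEN TWO SMALL BACKGROUNDS ON THE DIAGONAL,
# LETTER-FREE — `‖⟨u, Δ̃_{a,k}(U)v⟩ − ⟨u, Δ̃_{a,k}(V)v⟩‖ ≤ Θ·δ·N₁(u)N₁(v)` WITH ONE `∃ α₀ δ₀ Θ` BEFORE EVERY BINDER** — the π twin ((T4)-1) of this lineage's
# `B9Eq353FormDefectTowerTwoBackgrounds` (the same letter at the chain's `G₀`-slot `Δ_{a,k} = B9Eq326OperatorTower.laplaceAk`), obtained from it and the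
# two-background θ-defect `B9Eq3120DeltaPiPrimeFormTwoBackgroundsClosed` by `Δ̃_{a,k}(X) − Δ_{a,k}(X) = π_k(X)†Δ^η(X)π_k(X) − Δ^η(X)`

statement-level skeleton of published theorems with citation tags; proofs where landed; nothing here is a claim about the Yang–Mills mass gap

PDF held: `paper:balaban1985-cmp99-background-propagators` (journal page = PDF page + 388), pp. 395, 400, 407, 419–421 — read by this lineage first-hand (gens 73–78)
and through the suppliers' verbatim quotations.

CITATION HEADER (lean-in-tree rule 2026-08-18).  Audit cell `pub-balaban`, sub-cell `t4`, NE9 crux team (2): LEAF PROVER 04 (`b2b-balaban-t4-ne9-formalise-leaf-04`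
gen 79), INTENT-3 = (T4)-1 (the first π twin; the row OWNER t4-ne9-p1's GO `CLAIMS.log` l.53352 W-9 (α) «(T3)∕(T4) the π twins … for the successor»).  WHY (cell
context; DIAGNOSIS D-ne9p1-g87-1): the chain's two-background energy rows between `U` and `V` (gen 77∕78: `…GreenkLipschitzEnergyTwoBackgrounds(Letterfree)` →
`…H1k∕FrakGk…TwoBackgrounds` → `B9Eq3126EnergyBallTowerTwoBackgrounds` → `B11Eq117∕174…TwoBackgrounds`) all start from ONE letter, the two-background form defect
of `Δ_{a,k}` (`B9Eq353FormDefectTowerTwoBackgrounds`); their π twins at print's operator (3.122) start from THIS file in exactly the same way (next: the π twin of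
`B9Eq386GreenkLipschitzEnergyTwoBackgroundsLetterfree` with `B9Thm311LaplaceAkPiPositiveDiagonal.exists_laplaceAkPi_coercive_diagonal_closed` at `U` and at `V`).

THE PRINT.  p. 420 (3.122) and (verbatim via the OWNER's `B9Eq3119DeltaPiTower`) *«we will prove that this term is a small perturbation of Δ_a, and that the operator
G used in the above formula has all the properties formulated in Theorems 3.3, 3.10, 3.11»*; p. 400 Thm 3.4 (verbatim via (T2)): *«G(U) is an analytic function of U′
on the space of configurations U′ satisfying (3.35)»* — read in the cell as Lipschitz continuity between two points of the small-field ball, to first order.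

WHAT IS PROVED (sorry-free; proof lane — no `def`, no `Prop` placeholder; [folklore] composition BY NAME + one unfolding identity).
* **`inner_laplaceAkPi_sub_inner_laplaceAk`** — `⟨u, Δ̃_{a,k}(X)v⟩ − ⟨u, Δ_{a,k}(X)v⟩ = ⟨u, (π_k(X)†Δ^η(X)π_k(X))v⟩ − ⟨u, Δ^η(X)v⟩` (unfolding `laplaceALatticeK` ∕
  `laplaceAK_apply`: the `D R_k D*` and `Q_k*aQ_k` terms are common).
* **`exists_form_defect_pi_two_backgrounds_letterfree`** — `∃ α₀ δ₀ Θ > 0` (closed in `(d, a, a′, L, M_φ, M_φ′, r, C_τ, ρ_w)`) such that, with the binder list of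
  `B9Eq386GreenkLipschitzEnergyTwoBackgroundsLetterfree` (E162's per-level data for `U` and `V`, the base at `V` also `≤ 1∕128`; common level smallness `ε_j ≤ αr^j`
  (`j < n+1`), level closeness `δ_j ≤ δr^j`; `hRS` ×2; `U1` ×2; bond windows `αη` ×2; plaquette windows `αη²` ×2; closeness `δη`, `δη²`; `0 ≤ α ≤ α₀`, `0 ≤ δ ≤ δ₀`)
  and ANY positivity witnesses `hpos′_U`, `hpos′_V` of `Δ′_{a′,k}(U)`, `Δ′_{a′,k}(V)` (defining `G′_k`): for all `u, v`,
  `‖⟨u, laplaceAkPi … U … v⟩ − ⟨u, laplaceAkPi … V … v⟩‖ ≤ Θ·δ·N₁(u)N₁(v)`, `N₁(w) = √(‖curl₁w‖² + ‖div₁w‖² + ‖w‖²)`.  MECHANISM: the identity above at `U` and at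
  `V`; the `G₀`-slot letter `exists_form_defect_two_backgrounds_diagonal_closed` with its `R`-letter `C_R^{(2)}δ` DISCHARGED by
  `B9Eq325RLipschitzSqrtTowerTwoBackgroundsLinear.exists_norm_RofUk_sub_RofUk_le_two_backgrounds` (as in the gen-77 `…Letterfree` file; the level averages are
  `U1`-valued by `hLb_of_hU1`); the θ-defect letter `exists_form_defect_pi_sub_diagonal_closed`; `α₀`, `δ₀` minima, `Θ = Θ̄₂ + Θ₂`.
MODEL ∕ DECLARED READINGS.  (M1)–(M2) of `B9Eq353FormDefectTowerTwoBackgrounds` and of (T2): every window ∕ profile ∕ closeness letter, E162's data, `hRS`, `ρ_w`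
and the witnesses are HYPOTHESES; the Lipschitz continuity `U ↦ Ū` of the level averages (`δ_j`) is NOT proved.
HONEST SCOPE.  [folklore] composition BY NAME; FIRST order between two small backgrounds on the diagonal ONLY; crude constants; no kernel bound, no decay, no
analyticity; NOT the π-slot energy rows themselves (the next (T4) files).  NOT summit progress (cell pub-balaban: NE9 NOT PRINTED ∕ NOT PROVED; «NE9 ⇐ the named
binders»; row WALLED ON A MODEL (O-NE9-1; NEEDS-COORDINATOR #5 UNRULED); spine PROVED 0∕9; rung (B)+1 finite T⁴ — NOT infinite volume, NOT mass gap, NOT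
BetaPertH, NOT Clay).  HONEST DEPENDENCY (cell line): continuum YM on T⁴ ⇐ BetaPertH ∧ nine spine estimates (0/9 proved); BetaPertH ⇐ (D1) ∧ (D4) ∧ CAP+tail;
G-an2-4 gates asym, D1 and NE2/3/4.  NEW file; nothing modified.  Net new unproved facts: 0.
-/

noncomputable section

open scoped InnerProductSpace ComplexConjugate BigOperators

namespace Literature.MathematicalPhysics.QuantumFieldTheory.Balaban1983to89.B9Eq353FormDefectTowerPiTwoBackgrounds

open B4Sect5Torus (TSite)
open B9SectCLatticeCarrier (Bond)
open B11Eq103H1Complex (SiteL2K BondL2K covDerivL2K covDivL2K laplaceALatticeK laplaceAK_apply)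
open B9Eq310HessianOperator (adTransportW hessOp covCurlL2K)
open B9Eq310DeltaPrime (plaqHolU)
open B9Eq315QTorus (perCfg cornerSite)
open B9Eq315QTower (towerP UlevOf)
open B9Eq326OperatorTower (laplaceAk QkW RofUk)
open B9Eq324DeltaPrimeATower (laplacePrimeAk GpOfUk)
open B9Eq3119DeltaPiTower (piOfUk laplaceAkPi)
open B7Prop1Explicit (U1 Wcx boxVec)
open B9Thm311SmallFieldCoercivityTowerClosed (hLb_of_hU1)
open B9Eq325RLipschitzSqrtTowerTwoBackgroundsLinear (exists_norm_RofUk_sub_RofUk_le_two_backgrounds)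
open B9Eq353FormDefectTowerTwoBackgrounds (exists_form_defect_two_backgrounds_diagonal_closed)
open B9Eq3120DeltaPiPrimeFormTwoBackgroundsClosed (exists_form_defect_pi_sub_diagonal_closed)

variable {d : ℕ} (L : ℕ) [NeZero L] (hL : 1 ≤ L)
  {𝔸 : Type*} [NormedRing 𝔸] [NormedAlgebra ℂ 𝔸] [CompleteSpace 𝔸] [NormOneClass 𝔸] [StarRing 𝔸] [NormedStarGroup 𝔸] [StarModule ℂ 𝔸]
  {W : Type*} [NormedAddCommGroup W] [InnerProductSpace ℂ W] [FiniteDimensional ℂ W] (φ : W ≃ₗ[ℂ] 𝔸)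
  {Mφ Mφ' : ℝ} (hMφ : 0 ≤ Mφ) (hMφ' : 0 ≤ Mφ') (hφ : ∀ w, ‖φ w‖ ≤ Mφ * ‖w‖) (hφ' : ∀ X, ‖φ.symm X‖ ≤ Mφ' * ‖X‖)
  {a : ℝ} (ha : 0 < a) {a' : ℝ} (ha' : 0 < a') {r : ℝ} (hr0 : 0 ≤ r) (hr1 : r < 1)
  (τ : 𝔸 →ₗ[ℂ] ℂ) {Cτ : ℝ} (hτ : ∀ X, ‖τ X‖ ≤ Cτ * ‖X‖) (hCτ : 0 ≤ Cτ) {ρw : ℝ} (hρw : 0 ≤ ρw)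

/-! ## §1 `Δ̃_{a,k}(X) − Δ_{a,k}(X) = π_k(X)†Δ^η(X)π_k(X) − Δ^η(X)` in the form -/

omit [NormedStarGroup 𝔸] in
/-- **`⟨u, Δ̃_{a,k}(X)v⟩ − ⟨u, Δ_{a,k}(X)v⟩ = ⟨u, (π_k(X)†Δ^η(X)π_k(X))v⟩ − ⟨u, Δ^η(X)v⟩`** — (3.122) against (3.26): the two operators share the
`D_XR_k(X)D*_X` and `Q_k(X)*aQ_k(X)` terms and differ in the `Δ₁`-slot only. [cite: Balaban1985BackgroundPropagators, (3.122) p.420, (3.26) p.395] -/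
theorem inner_laplaceAkPi_sub_inner_laplaceAk (m : Fin d → ℕ) [∀ i, NeZero (m i)] (n : ℕ) {c₀ c₁ : ℝ} [Fact (0 < c₀)] [Fact (0 < c₁)] (η : ℝ)
    (X : Bond d (towerP L m (n + 1)) → 𝔸ˣ) (αX : ℕ → ℝ) (hα1 : ∀ j, αX j ≤ 1 / 64)
    (hX1 : ∀ (j : ℕ) (x : B7Prop1Explicit.Site d) (κ : Fin d), perCfg (towerP L m (j + 1)) (UlevOf L m (n + 1) X j) x κ ∈ U1 𝔸)
    (hreg : ∀ (j : ℕ) (y : TSite d (towerP L m j)) (κ : Fin d) (r : Fin d → Fin L),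
      ‖((Wcx L (perCfg (towerP L m (j + 1)) (UlevOf L m (n + 1) X j)) (cornerSite L y) κ (boxVec L r) : 𝔸ˣ) : 𝔸) - 1‖ ≤ αX j)
    (hpos' : ∀ x : SiteL2K ℂ d (towerP L m (n + 1)) c₀ W, x ≠ 0 → 0 < RCLike.re ⟪x, laplacePrimeAk L m n φ η X a' (c₁ := c₁) x⟫_ℂ)
    (u v : BondL2K ℂ d (towerP L m (n + 1)) c₀ W) :
    ⟪u, laplaceAkPi L m n φ τ η X a' hpos' hL αX hα1 hX1 hreg (c₁ := c₁) a v⟫_ℂ - ⟪u, laplaceAk L m n φ η X hL αX hα1 hX1 hreg τ (c₀ := c₀) (c₁ := c₁) a v⟫_ℂ =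
      ⟪u, (LinearMap.adjoint (piOfUk L m n φ η X (GpOfUk L m n φ η X a' hpos')) ∘ₗ hessOp φ η X τ ∘ₗ
            piOfUk L m n φ η X (GpOfUk L m n φ η X a' hpos')) v⟫_ℂ - ⟪u, hessOp φ η X τ v⟫_ℂ := by
  simp only [laplaceAkPi, laplaceAk, laplaceALatticeK, laplaceAK_apply, inner_add_right]
  ring

/-! ## §2 The form defect of `Δ̃_{a,k}` between two small backgrounds, letter-free -/

include hMφ hMφ' hφ hφ' ha ha' hr0 hr1 hτ hCτ hρw in
/-- **THE FORM DEFECT OF PRINT's `Δ̃_{a,k}` ((3.122)) BETWEEN TWO SMALL BACKGROUNDS ON THE DIAGONAL, LETTER-FREE** — see the module header: `∃ α₀ δ₀ Θ > 0`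
before every binder; then, under the binder list of `B9Eq386GreenkLipschitzEnergyTwoBackgroundsLetterfree` plus ANY `hpos′_U`, `hpos′_V` (defining `G′_k` at `U`,
`V`): `‖⟨u, Δ̃_{a,k}(U)v⟩ − ⟨u, Δ̃_{a,k}(V)v⟩‖ ≤ Θ·δ·N₁(u)N₁(v)` — the `G₀`-slot letter `B9Eq353FormDefectTowerTwoBackgrounds` (its `C_R^{(2)}` discharged) plus
the θ-defect letter `B9Eq3120DeltaPiPrimeFormTwoBackgroundsClosed`, through §1 at `U` and at `V`. [folklore]
[cite: Balaban1985BackgroundPropagators, (3.122) p.420, (3.119)–(3.120) p.419, (3.26) p.395, (3.52)–(3.53) p.400, (3.82)–(3.86) p.407, Thm 3.4 p.400, (3.35) p.396] -/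
theorem exists_form_defect_pi_two_backgrounds_letterfree :
    ∃ α₀ δ₀ Θ : ℝ, 0 < α₀ ∧ 0 < δ₀ ∧ 0 < Θ ∧ ∀ (n : ℕ) (η : ℝ), η * (L : ℝ) ^ (n + 1) = 1 →
      ∀ (c₀ c₁ : ℝ) [Fact (0 < c₀)] [Fact (0 < c₁)], c₀ * ((L : ℝ) ^ (n + 1)) ^ d = c₁ → |η| ^ d / c₀ ≤ ρw →
      ∀ (m : Fin d → ℕ) [∀ i, NeZero (m i)] (U V : Bond d (towerP L m (n + 1)) → 𝔸ˣ) (αU : ℕ → ℝ) (hα1 : ∀ j, αU j ≤ 1 / 64)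
        (hU1 : ∀ (j : ℕ) (x : B7Prop1Explicit.Site d) (κ : Fin d), perCfg (towerP L m (j + 1)) (UlevOf L m (n + 1) U j) x κ ∈ U1 𝔸)
        (hreg : ∀ (j : ℕ) (y : TSite d (towerP L m j)) (κ : Fin d) (r : Fin d → Fin L),
          ‖((Wcx L (perCfg (towerP L m (j + 1)) (UlevOf L m (n + 1) U j)) (cornerSite L y) κ (boxVec L r) : 𝔸ˣ) : 𝔸) - 1‖ ≤ αU j)
        (αV : ℕ → ℝ) (hα1' : ∀ j, αV j ≤ 1 / 64)
        (hV1 : ∀ (j : ℕ) (x : B7Prop1Explicit.Site d) (κ : Fin d), perCfg (towerP L m (j + 1)) (UlevOf L m (n + 1) V j) x κ ∈ U1 𝔸)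
        (hregV : ∀ (j : ℕ) (y : TSite d (towerP L m j)) (κ : Fin d) (r : Fin d → Fin L),
          ‖((Wcx L (perCfg (towerP L m (j + 1)) (UlevOf L m (n + 1) V j)) (cornerSite L y) κ (boxVec L r) : 𝔸ˣ) : 𝔸) - 1‖ ≤ αV j),
        (∀ j, αV j ≤ 1 / 128) →
      ∀ (εU : ℕ → ℝ), (∀ j, 0 ≤ εU j) → (∀ (j : ℕ) (b : Bond d (towerP L m (j + 1))), ‖(UlevOf L m (n + 1) U j b : 𝔸) - 1‖ ≤ εU j) →
        (∀ (j : ℕ) (b : Bond d (towerP L m (j + 1))), ‖(UlevOf L m (n + 1) V j b : 𝔸) - 1‖ ≤ εU j) →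
      ∀ (δUV : ℕ → ℝ), (∀ j, 0 ≤ δUV j) →
        (∀ (j : ℕ) (b : Bond d (towerP L m (j + 1))), ‖(UlevOf L m (n + 1) U j b : 𝔸) - (UlevOf L m (n + 1) V j b : 𝔸)‖ ≤ δUV j) →
      ∀ {α δ : ℝ}, 0 ≤ α → α ≤ α₀ → 0 ≤ δ → δ ≤ δ₀ →
        (∀ (b : Bond d (towerP L m (n + 1))) (v u : W), ⟪adTransportW φ U b v, u⟫_ℂ = ⟪v, adTransportW φ (fun b => (U b)⁻¹) b u⟫_ℂ) →
        (∀ (b : Bond d (towerP L m (n + 1))) (v u : W), ⟪adTransportW φ V b v, u⟫_ℂ = ⟪v, adTransportW φ (fun b => (V b)⁻¹) b u⟫_ℂ) →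
        (∀ b, U b ∈ U1 𝔸) → (∀ b, V b ∈ U1 𝔸) → (∀ b, ‖(U b : 𝔸) - 1‖ ≤ α * η) → (∀ b, ‖(V b : 𝔸) - 1‖ ≤ α * η) →
        (∀ p : B9SectCLatticeCarrier.Plaq d (towerP L m (n + 1)), ‖(plaqHolU U p : 𝔸) - 1‖ ≤ α * η ^ 2) →
        (∀ p : B9SectCLatticeCarrier.Plaq d (towerP L m (n + 1)), ‖(plaqHolU V p : 𝔸) - 1‖ ≤ α * η ^ 2) →
        (∀ b, ‖(U b : 𝔸) - (V b : 𝔸)‖ ≤ δ * η) →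
        (∀ p : B9SectCLatticeCarrier.Plaq d (towerP L m (n + 1)), ‖(plaqHolU U p : 𝔸) - (plaqHolU V p : 𝔸)‖ ≤ δ * η ^ 2) →
        (∀ j < n + 1, εU j ≤ α * r ^ j) → (∀ j, δUV j ≤ δ * r ^ j) →
        ∀ (hposU' : ∀ x : SiteL2K ℂ d (towerP L m (n + 1)) c₀ W, x ≠ 0 → 0 < RCLike.re ⟪x, laplacePrimeAk L m n φ η U a' (c₁ := c₁) x⟫_ℂ)
          (hposV' : ∀ x : SiteL2K ℂ d (towerP L m (n + 1)) c₀ W, x ≠ 0 → 0 < RCLike.re ⟪x, laplacePrimeAk L m n φ η V a' (c₁ := c₁) x⟫_ℂ)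
          (u v : BondL2K ℂ d (towerP L m (n + 1)) c₀ W),
          ‖⟪u, laplaceAkPi L m n φ τ η U a' hposU' hL αU hα1 hU1 hreg (c₁ := c₁) a v⟫_ℂ -
              ⟪u, laplaceAkPi L m n φ τ η V a' hposV' hL αV hα1' hV1 hregV (c₁ := c₁) a v⟫_ℂ‖ ≤
            Θ * δ * Real.sqrt (‖covCurlL2K ℂ c₀ ((η : ℂ))⁻¹ (adTransportW φ (fun _ : Bond d (towerP L m (n + 1)) => (1 : 𝔸ˣ))) u‖ ^ 2 +
                ‖covDivL2K ℂ c₀ ((η : ℂ))⁻¹ (adTransportW φ fun _ : Bond d (towerP L m (n + 1)) => (1 : 𝔸ˣ)⁻¹) u‖ ^ 2 + ‖u‖ ^ 2) *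
              Real.sqrt (‖covCurlL2K ℂ c₀ ((η : ℂ))⁻¹ (adTransportW φ (fun _ : Bond d (towerP L m (n + 1)) => (1 : 𝔸ˣ))) v‖ ^ 2 +
                ‖covDivL2K ℂ c₀ ((η : ℂ))⁻¹ (adTransportW φ fun _ : Bond d (towerP L m (n + 1)) => (1 : 𝔸ˣ)⁻¹) v‖ ^ 2 + ‖v‖ ^ 2) := by
  obtain ⟨αR, CR, hαR, hCR, HR⟩ := exists_norm_RofUk_sub_RofUk_le_two_backgrounds (d := d) L φ hMφ hMφ' hφ hφ' hr0 hr1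
  obtain ⟨α₇, δ₇, Θ₇, hα₇, hδ₇, hΘ₇, H7⟩ :=
    exists_form_defect_two_backgrounds_diagonal_closed L hL φ hMφ hMφ' hφ hφ' ha hr0 hr1 τ hτ hCτ hρw hCR.le
  obtain ⟨α₂, δ₂, Θ₂, hα₂, hδ₂, hΘ₂, H2⟩ := exists_form_defect_pi_sub_diagonal_closed (d := d) L φ hMφ hMφ' hφ hφ' ha' hr0 hr1 τ hτ hCτ hρw
  refine ⟨min αR (min α₇ α₂), min δ₇ δ₂, Θ₇ + Θ₂, lt_min hαR (lt_min hα₇ hα₂), lt_min hδ₇ hδ₂, add_pos hΘ₇ hΘ₂, ?_⟩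
  intro n η hηL c₀ c₁ _ _ hw hρ m _ U V αU hα1 hU1 hreg αV hα1' hV1 hregV hα128 εU hεU hUε hVε δUV hδUV hLUV α δ hα0 hαle hδ0 hδle
    hRSU hRSV hUb hVb hUη hVη hplU hplV hUV hpp hεg hδg hposU' hposV' u v
  have hαR' : α ≤ αR := hαle.trans (min_le_left _ _)
  have hα₇' : α ≤ α₇ := hαle.trans ((min_le_right _ _).trans (min_le_left _ _))
  have hα₂' : α ≤ α₂ := hαle.trans ((min_le_right _ _).trans (min_le_right _ _))
  have hδ₇' : δ ≤ δ₇ := hδle.trans (min_le_left _ _)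
  have hδ₂' : δ ≤ δ₂ := hδle.trans (min_le_right _ _)
  have hLbU := hLb_of_hU1 L m n U hU1
  have hLbV := hLb_of_hU1 L m n V hV1
  have hδg' : ∀ j < n + 1, δUV j ≤ δ * r ^ j := fun j _ => hδg j
  have hR2 : ∀ s : SiteL2K ℂ d (towerP L m (n + 1)) c₀ W, ‖RofUk L m n φ η U s - RofUk L m n φ η V s‖ ≤ CR * δ * ‖s‖ :=
    HR n η hηL c₀ c₁ hw m U V εU δUV hεU hδUV hUε hVε hLbU hLbV hLUV hα0 hαR' hδ0 hRSU hRSV hUb hVb hUη hVη hUV hεg hδg'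
  have h7 := H7 n η hηL c₀ c₁ hw hρ m U V αU hα1 hU1 hreg αV hα1' hV1 hregV hα128 εU hεU hUε hVε δUV hδUV hLUV hα0 hα₇' hδ0 hδ₇' hRSU hRSV hUb hVb
    hUη hVη hplU hUV hpp hεg hδg hR2 u v
  have h2 := H2 n η hηL c₀ c₁ hw hρ m U V hRSU hRSV α δ hα0 hα₂' hδ0 hδ₂' hUb hVb hUη hVη hUV hplU hplV hpp εU δUV hεU hδUV hεg hδg' hUε hVε
    hLbU hLbV hLUV hposU' hposV' u v
  have e : ⟪u, laplaceAkPi L m n φ τ η U a' hposU' hL αU hα1 hU1 hreg (c₁ := c₁) a v⟫_ℂ -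
      ⟪u, laplaceAkPi L m n φ τ η V a' hposV' hL αV hα1' hV1 hregV (c₁ := c₁) a v⟫_ℂ =
      (⟪u, laplaceAk L m n φ η U hL αU hα1 hU1 hreg τ (c₀ := c₀) (c₁ := c₁) a v⟫_ℂ -
          ⟪u, laplaceAk L m n φ η V hL αV hα1' hV1 hregV τ (c₀ := c₀) (c₁ := c₁) a v⟫_ℂ) +
        ((⟪u, (LinearMap.adjoint (piOfUk L m n φ η U (GpOfUk L m n φ η U a' hposU')) ∘ₗ hessOp φ η U τ ∘ₗ
              piOfUk L m n φ η U (GpOfUk L m n φ η U a' hposU')) v⟫_ℂ - ⟪u, hessOp φ η U τ v⟫_ℂ) -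
          (⟪u, (LinearMap.adjoint (piOfUk L m n φ η V (GpOfUk L m n φ η V a' hposV')) ∘ₗ hessOp φ η V τ ∘ₗ
              piOfUk L m n φ η V (GpOfUk L m n φ η V a' hposV')) v⟫_ℂ - ⟪u, hessOp φ η V τ v⟫_ℂ)) := by
    rw [← inner_laplaceAkPi_sub_inner_laplaceAk L hL φ τ m n η U αU hα1 hU1 hreg hposU' u v,
      ← inner_laplaceAkPi_sub_inner_laplaceAk L hL φ τ m n η V αV hα1' hV1 hregV hposV' u v]
    ring
  rw [e]
  refine (norm_add_le _ _).trans ((add_le_add h7 h2).trans_eq ?_)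
  ring

end Literature.MathematicalPhysics.QuantumFieldTheory.Balaban1983to89.B9Eq353FormDefectTowerPiTwoBackgrounds

end
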